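import Summits.QuantumFields.YangMills.Theorems.BalabanUVNodesN06D2SupLegAtPinsPUWQ
import Summits.QuantumFields.YangMills.Theorems.BalabanUVNodesN06Delta2AtPinsPhysPQJ

/-!
# BalabanUVNodes ∕ N06 ([B9], `Dag.B9_main`) — R1 J-TWIN 4∕≈18: THE CERTIFICATE's (3.137) LETTER `hD2sup` OVER A GENERIC AVERAGING PAIR `(𝔮, 𝔮⋆)` AND SITE
# TRANSPORTER `parT`, ALONG A SUB-FAMILY `f : J → MemberY …` — the J-twin of ✓`…N06D2SupLegAtPinsPUWQ.d2sup_of_pins_q` (dag-n06-l g38, P-D2-knit leg T-g)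

Track A of `YM-PLAN.md` (cell `pub-ymgap`, HUMAN RULING D-0062), node **N06** = [Balaban1985BackgroundPropagators]; IR-N06-SECTION-2 road **R1** («J-twin of the
producer cone», ★★★ director-ym №524 (3): authorised in principle, STAGED, sibling files only, one file on a by-name ask), dag-n06-d's `R1-JTWIN-SPEC.md` rule (R)′
(2026-08-31): re-key EXACTLY the section-tainted ∀-member rows along `f`, keep data ∕ pins ∕ laws ∕ section-free rows member-wide, conclusions along `f`.
Seat `pub-ymgap-dag-n06-l` g41 (R1 ORDER: after its one family-wide callee (8)ᴶ = ✓`…N06Delta2AtPinsPhysPQJ`; consumer to come: `…N06D2SupPrechainV2AtPinsPUWQ`ᴶ).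

WHAT.  `d2sup_of_pins_q_J` = the parent's ★★★ `d2sup_of_pins_q` with `{J : Type} (f : J → MemberY θ.d₆ θ.ℓ₆ θ.hd' θ.hL' θ.b₀ θ.b₁ Mstar)` added after the `H` binder and
* TAINTED ROWS OF THIS TWIN (provenance through rows 15∕16∕17 at the head): `hGD` — the scaled sup letter of `G̃[𝔮]` at the ops object (P-D2-knit (7) PASS 1 ⟸ the
  state layer ⟸ (3.49) `h49` ⟸ (3.48) `h348`) and `hc2` — the (3.132) class letter of `C[𝔮]` (⟸ `CoerciveUnder` ⟸ ROW 17 `hΔ`): `∀ x : MemberY … ↦ ∀ j : J`, read at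
  `f j`; the two rows DERIVED from them inside (`hGDsup`, `hCsup`, fed to (8)ᴶ) are J-keyed accordingly;
* LEFT member-wide: the letter families `𝔮 𝔮⋆ parT 𝔬12 bI 𝔠 H`, the pins `hbI0 hβ1 hblk12 hblkZ12 hGco12 hCco12`, the class bridge `hRP2` and r06's cube covering
  derived from it (`hreg`), the laws `hadj hGDsym hQ15`, the SECTION-FREE row `hC2` ([5] (149), def-Y's torus letters) and every numeric;
* conclusion `∃ MD aD θ₂, 0 < aD ∧ aD ≤ aG ∧ 0 ≤ θ₂ ∧ ∀ j : J, … (f j) …` (rule (R)′.3).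
PROOF: the parent's text by generator (`mkJ9.py` over the tree bytes): the two derived-row blocks re-keyed (`intro j`, member reads `x ↦ f j`, `hGD j`, `hc2 j`), the
scaled road read through (8)ᴶ `hD2sup_of_GD_C_lettersRP_sq_q_J … f …`, the closing lambda `fun j`; nothing re-derived.  The member-wide parent is the instance
`J := MemberY …`, `f := id`.  Until `…N06D2SupPrechainV2AtPinsPUWQ`ᴶ lands this file is an ORPHAN by design (honest).
HONEST FRAMING: kernel bookkeeping re-indexed; every analytic member a HYPOTHESIS of printed species ([5] (149) included); COUNT-NEUTRAL
(`--supports stmt-QuantumFields-27239 --as helper`); N06 NOT discharged; under R1 the inner-corner question stays DISPLAYED at the K1 face ∕ NODE O join by (α5);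
nothing continuum ∕ OS ∕ mass gap ∕ Clay.  0 `def`, 0 `sorry`.  NEW file; the parent untouched.
[cite: Balaban1985BackgroundPropagators, (3.134)–(3.137) pp.422–423, (3.126) p.420, (3.130) p.421, (3.132)–(3.133) p.422, (3.115) p.418, (3.36) p.396, p.398, p.421;
Balaban1985Averaging, (149) p.40; Balaban1984PropagatorsII, (2.51) p.232, (2.54)–(2.56) p.233, Lemma 2.1 (2.60)–(2.61) p.234]
-/

noncomputable section

namespace Summit.QuantumFields.YangMills.BalabanUVNodes.N06D2SupLegAtPinsPUWQJ


open Literature.MathematicalPhysics.QuantumFieldTheory.Balaban1983to89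
open Literature.MathematicalPhysics.QuantumFieldTheory.Balaban1983to89.Node00 (CfgY FBondY IBondY GpY GpPhysY parSymY parBY trDualMatY trAdjY JY Stage3Params C2Y
  delta2OfY etaBY)
open Literature.MathematicalPhysics.QuantumFieldTheory.Balaban1983to89.Node00.OpsYSectDCoords (QcoKH CcoK cR39_trBasis_pos)
open Literature.MathematicalPhysics.QuantumFieldTheory.Balaban1983to89.B9Eq3132SectDLetters (GDY HDY)
open Literature.MathematicalPhysics.QuantumFieldTheory.Balaban1983to89.B9Thm34Ext (toB6)
open Literature.MathematicalPhysics.QuantumFieldTheory.Balaban1983to89.B6RandomWalk (HasMajorant hasMajorant_mono)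
open Literature.MathematicalPhysics.QuantumFieldTheory.Balaban1983to89.B6RandomWalkHom (HasMajorantHom hasMajorantHom_mono hasMajorantHom_iff)
open Literature.MathematicalPhysics.QuantumFieldTheory.Balaban1983to89.B11SectG (HasMaj BlockNorm RowSum)
open Literature.MathematicalPhysics.QuantumFieldTheory.Balaban1983to89.B9Thm312Whole (GeoOK cNorm)
open Literature.MathematicalPhysics.QuantumFieldTheory.Balaban1983to89.B9SectDSup (weightNorm)
open Literature.MathematicalPhysics.QuantumFieldTheory.Balaban1983to89.B9RWSums343to347Whole (Facts347)
open Literature.MathematicalPhysics.QuantumFieldTheory.Balaban1983to89.B9RWSumsDefinitePins (PinPrims)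
open Literature.MathematicalPhysics.QuantumFieldTheory.Balaban1983to89.B9RWSums347DefiniteFaces (facts347_exp261_geo9Y)
open Literature.MathematicalPhysics.QuantumFieldTheory.Balaban1983to89.B9RowSum261DefiniteFaces (rowConst261 rowConst261_nonneg)
open Literature.MathematicalPhysics.QuantumFieldTheory.Balaban1983to89.B9PinMembersKLevelV1 (MemberY geo9Y)
open Literature.MathematicalPhysics.QuantumFieldTheory.Balaban1983to89.B9PinGeometryKLevelV1 (c35Y)
open Literature.MathematicalPhysics.QuantumFieldTheory.Balaban1983to89.B9PinGeometryKLevelV1B (c35Y_le_ten)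
open Literature.MathematicalPhysics.QuantumFieldTheory.Balaban1983to89.B9BackgroundsKLevelV1R (RegFamY bg9YR MemOfFam)
open Literature.MathematicalPhysics.QuantumFieldTheory.Balaban1983to89.B9BackgroundsKLevelV1P (bg9YP)
open Literature.MathematicalPhysics.QuantumFieldTheory.Balaban1983to89.B9GeoLemma21KLevelV1 (geo9Y_len_pos geo9Y_dist_triangle geo9Y_dist_comm)
open Literature.MathematicalPhysics.QuantumFieldTheory.Balaban1983to89.B9GeoNormsKLevelV1 (geo9K geo9K_dist_nonneg)
open Literature.MathematicalPhysics.QuantumFieldTheory.Balaban1983to89.B7Prop2SpecialUnitary (specialUnitaryUnits)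
open Literature.MathematicalPhysics.QuantumFieldTheory.Balaban1983to89.B9CoReadingCoords (XBK blkBK GcoK)
open Literature.MathematicalPhysics.QuantumFieldTheory.Balaban1983to89.B9CoReadingCoordsH (XHK blkHK)
open Literature.MathematicalPhysics.QuantumFieldTheory.Balaban1983to89.B9CoReadingCoordsS (XSK)
open Literature.MathematicalPhysics.QuantumFieldTheory.Balaban1983to89.B9CoReadingCoordsTranspose (TrIdx trBasis)
open Literature.MathematicalPhysics.QuantumFieldTheory.Balaban1983to89.B9Thm39ReadingCoords (cR39 basisBound39)
open Literature.MathematicalPhysics.QuantumFieldTheory.Balaban1983to89.B9PerturbationL2Delta2 (D2coK)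
open Literature.MathematicalPhysics.QuantumFieldTheory.Balaban1983to89.B9Delta2FormMajorant (C2FormMaj)
open Literature.MathematicalPhysics.QuantumFieldTheory.Balaban1983to89.B9SupLettersFromClassLetters (hasMajorantHom_of_hasMaj_cNorm_weightNorm)
open Literature.MathematicalPhysics.QuantumFieldTheory.Balaban1983to89.B9Eq336RegularAtAllBondsP (regularAt_pinScale_of_regYP336)
open Literature.MathematicalPhysics.QuantumFieldTheory.Balaban1983to89.B9LettersHZAtOne (plateau_pos)
open B6Ineq2142KLevelV1 (β lvl)
open B6GlobalChartV1 (blkV1)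
open B6Geom246MultiLevelTorus (geomT)
open Summit.QuantumFields.YangMills.BalabanUVNodes.N06Delta2AtPinsPhysPQJ (hD2sup_of_GD_C_lettersRP_sq_q_J)
open Literature.MathematicalPhysics.QuantumFieldTheory.Balaban1983to89.Node00 (GDQY delta2OfQY)
open Literature.MathematicalPhysics.QuantumFieldTheory.Balaban1983to89.Node00.OpsYOps312OfRecordPar (QcoKHq CcoKq)
open Literature.MathematicalPhysics.QuantumFieldTheory.Balaban1983to89.B9Thm311ReadingCoords (IsAdjTr IsSymmTr)
open scoped Matrix.Norms.L2Operator

variable {N : ℕ} [NeZero N] {θ : Stage3Params} {Mstar : ℕ}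
variable [∀ x : MemberY θ.d₆ θ.ℓ₆ θ.hd' θ.hL' θ.b₀ θ.b₁ Mstar, Fintype (geo9Y x).Site]

/-- the product weight of the road is print's: `(Lʲη)·n⁻¹ · ((n·(Lʲη)⁻²·(Lʲη)²)·(Lʲη)⁻³) = (Lʲη)⁻²`. [cite: Balaban1985BackgroundPropagators, (3.136)–(3.137) pp.422–423, bookkeeping] -/
private theorem weights_mul_eq {l p : ℝ} (hl : 0 < l) (hp : 0 < p) :
    l * p⁻¹ * ((p⁻¹⁻¹ * (l ^ 2)⁻¹ * l ^ 2) * (l ^ 3)⁻¹) = (l ^ 2)⁻¹ := by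
  field_simp

/-- ★★★ **THE CERTIFICATE's `hD2sup` ((3.137)) AS A THEOREM at `Δ2 := delta2OfY … GpPhysY … (𝔠 x).form`** (module docstring): from the scaled sup letter of `G_D`
before the leaf (`hGD`), the (3.132) class letter of `C` (`hc2`), the pins, the class bridge `hRP2`, [5] (149) at print's weight (`hC2`) and numerics — above a threshold `MD`,
in the produced regime `Mα₀ ≤ aD` (`0 < aD ≤ aG`), with the produced constant `θ₂ ≥ 0`:
`HasMajorant (𝔬12 x).blk (D2coK … ((delta2OfY … GpPhysY … (𝔠 x).form)) U) (θ₂·(M_xα₀)·(Lʲη)_a⁻²·e^{−δ₂ d})`.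
[cite: Balaban1985BackgroundPropagators, (3.134)–(3.137) pp.422–423, (3.126) p.420, (3.130) p.421, (3.132)–(3.133) p.422, (3.36) p.396, p.398, p.421; Balaban1985Averaging, (149) p.40; Balaban1984PropagatorsII, (2.51) p.232, (2.54)–(2.56) p.233, Lemma 2.1 (2.60)–(2.61) p.234] -/
theorem d2sup_of_pins_q_J (H : MemberY θ.d₆ θ.ℓ₆ θ.hd' θ.hL' θ.b₀ θ.b₁ Mstar → Prop) {J : Type} (f : J → MemberY θ.d₆ θ.ℓ₆ θ.hd' θ.hL' θ.b₀ θ.b₁ Mstar) (𝔠 : C2Y N θ Mstar)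
    {R₁ R₂ : RegFamY θ.d₆ θ.ℓ₆ θ.hd' θ.hL' θ.b₀ θ.b₁ Mstar (Matrix (Fin N) (Fin N) ℂ)} (c : ℝ)
    (𝔮 : ∀ x : MemberY θ.d₆ θ.ℓ₆ θ.hd' θ.hL' θ.b₀ θ.b₁ Mstar, Node00.OpsYQLetter.QLetterY (Matrix (Fin N) (Fin N) ℂ) x.toKIdx)
    (𝔮s : ∀ x : MemberY θ.d₆ θ.ℓ₆ θ.hd' θ.hL' θ.b₀ θ.b₁ Mstar, Node00.OpsYQLetter.QsLetterY (Matrix (Fin N) (Fin N) ℂ) x.toKIdx)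
    (parT : ∀ i : B6KLevelCensusIndexV1.KIdx θ.d₆ θ.ℓ₆ θ.hd' θ.hL' θ.b₀ θ.b₁, Node00.SiteParY (Matrix (Fin N) (Fin N) ℂ) i)
    (hRP2 : ∀ (x : MemberY θ.d₆ θ.ℓ₆ θ.hd' θ.hL' θ.b₀ θ.b₁ Mstar) (α₀ : ℝ) (U : (bg9YR (Matrix (Fin N) (Fin N) ℂ) (specialUnitaryUnits (Fin N)) R₁ R₂ x).Cfg),
      (bg9YR (Matrix (Fin N) (Fin N) ℂ) (specialUnitaryUnits (Fin N)) R₁ R₂ x).Reg336 c α₀ U →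
        0 ≤ α₀ ∧ (bg9YP (Matrix (Fin N) (Fin N) ℂ) (specialUnitaryUnits (Fin N)) x).Reg336 c35Y α₀ U)
    (𝔬12 : ∀ x : MemberY θ.d₆ θ.ℓ₆ θ.hd' θ.hL' θ.b₀ θ.b₁ Mstar, B9Thm312Whole.Ops (geo9Y x) (bg9YR (Matrix (Fin N) (Fin N) ℂ) (specialUnitaryUnits (Fin N)) R₁ R₂ x)
      (XBK (TrIdx N) x.toKIdx) (XBK (TrIdx N) x.toKIdx) (XHK (TrIdx N) x.toKIdx) (XSK (TrIdx N) x.toKIdx))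
    (bI : ∀ x : MemberY θ.d₆ θ.ℓ₆ θ.hd' θ.hL' θ.b₀ θ.b₁ Mstar, FBondY x.toKIdx → IBondY x.toKIdx)
    (hbI0 : ∀ (x : MemberY θ.d₆ θ.ℓ₆ θ.hd' θ.hL' θ.b₀ θ.b₁ Mstar) (f : FBondY x.toKIdx), bI x f = bI x ⟨f.src, 0⟩)
    (hβ1 : ∀ (x : MemberY θ.d₆ θ.ℓ₆ θ.hd' θ.hL' θ.b₀ θ.b₁ Mstar) (f : FBondY x.toKIdx), (geomT x.D).dist (β x.hN x.D x.hk (bI x f)) (blkV1 x.hN x.D f) ≤ 1)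
    (hblk12 : ∀ x : MemberY θ.d₆ θ.ℓ₆ θ.hd' θ.hL' θ.b₀ θ.b₁ Mstar, (𝔬12 x).blk = blkBK x.toKIdx (bI x))
    (hblkZ12 : ∀ x : MemberY θ.d₆ θ.ℓ₆ θ.hd' θ.hL' θ.b₀ θ.b₁ Mstar, (𝔬12 x).blkZ = blkHK x.toKIdx)
    (hGco12 : ∀ (x : MemberY θ.d₆ θ.ℓ₆ θ.hd' θ.hL' θ.b₀ θ.b₁ Mstar) (U : (bg9YR (Matrix (Fin N) (Fin N) ℂ) (specialUnitaryUnits (Fin N)) R₁ R₂ x).Cfg),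
      (𝔬12 x).G U = GcoK x.toKIdx (trBasis N) (bg9YR (Matrix (Fin N) (Fin N) ℂ) (specialUnitaryUnits (Fin N)) R₁ R₂ x) (fun U => U)
        (GDQY x.toKIdx (𝔮 x) (𝔮s x) (parT x.toKIdx) (GpPhysY x.toKIdx (parT x.toKIdx))) U)
    (hCco12 : ∀ (x : MemberY θ.d₆ θ.ℓ₆ θ.hd' θ.hL' θ.b₀ θ.b₁ Mstar) (U : (bg9YR (Matrix (Fin N) (Fin N) ℂ) (specialUnitaryUnits (Fin N)) R₁ R₂ x).Cfg),
      (𝔬12 x).C U = CcoKq x.toKIdx (trBasis N) (bg9YR (Matrix (Fin N) (Fin N) ℂ) (specialUnitaryUnits (Fin N)) R₁ R₂ x) (fun U => U)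
        (𝔮 x) (𝔮s x) (parT x.toKIdx) (GpPhysY x.toKIdx (parT x.toKIdx)) U)
    -- numerics: the regime of the inputs, their constants and rates, and the budget of the road
    {MG aG rG ρG Bz δC δ₂ κC δC2 : ℝ} (haG : 0 < aG) (hrG : 0 ≤ rG) (hρG : 0 < ρG) (hBz : 0 ≤ Bz) (hδC : 0 < δC) (hδ₂ : 0 ≤ δ₂) (hκC : 0 ≤ κC)
    (hgap : δ₂ < δC2)
    -- [P-D2-knit] the pair's adjointness, the symmetry of `G̃[𝔮](U)` and the (3.15) block law of `𝔮`, DISPLAYED on the carrier's regime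
    (hadj : ∀ (x : MemberY θ.d₆ θ.ℓ₆ θ.hd' θ.hL' θ.b₀ θ.b₁ Mstar) (α₀ : ℝ) (U : (bg9YR (Matrix (Fin N) (Fin N) ℂ) (specialUnitaryUnits (Fin N)) R₁ R₂ x).Cfg),
      (bg9YR (Matrix (Fin N) (Fin N) ℂ) (specialUnitaryUnits (Fin N)) R₁ R₂ x).Reg335 c α₀ U →
        IsAdjTr (fun _ => (1 : ℝ)) (fun _ => (1 : ℝ)) (𝔮 x U) (𝔮s x U))
    (hGDsym : ∀ x : MemberY θ.d₆ θ.ℓ₆ θ.hd' θ.hL' θ.b₀ θ.b₁ Mstar, MG ≤ (geo9Y x).M → ∀ α₀ : ℝ, 0 < α₀ → (geo9Y x).M * α₀ ≤ aG →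
      ∀ U : (bg9YR (Matrix (Fin N) (Fin N) ℂ) (specialUnitaryUnits (Fin N)) R₁ R₂ x).Cfg,
        (bg9YR (Matrix (Fin N) (Fin N) ℂ) (specialUnitaryUnits (Fin N)) R₁ R₂ x).Reg335 c α₀ U →
        (bg9YR (Matrix (Fin N) (Fin N) ℂ) (specialUnitaryUnits (Fin N)) R₁ R₂ x).Reg336 c α₀ U →
          IsSymmTr (fun _ => (1 : ℝ)) (GDQY x.toKIdx (𝔮 x) (𝔮s x) (parT x.toKIdx) (GpPhysY x.toKIdx (parT x.toKIdx)) U))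
    {BQ : ℝ} (hBQ : 0 ≤ BQ)
    (hQ15 : ∀ x : MemberY θ.d₆ θ.ℓ₆ θ.hd' θ.hL' θ.b₀ θ.b₁ Mstar, MG ≤ (geo9Y x).M → ∀ α₀ : ℝ, 0 < α₀ → (geo9Y x).M * α₀ ≤ aG →
      ∀ U : (bg9YR (Matrix (Fin N) (Fin N) ℂ) (specialUnitaryUnits (Fin N)) R₁ R₂ x).Cfg,
        (bg9YR (Matrix (Fin N) (Fin N) ℂ) (specialUnitaryUnits (Fin N)) R₁ R₂ x).Reg335 c α₀ U →
        (bg9YR (Matrix (Fin N) (Fin N) ℂ) (specialUnitaryUnits (Fin N)) R₁ R₂ x).Reg336 c α₀ U →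
          ∀ δ : ℝ, 0 ≤ δ → HasMajorantHom (g := toB6 (geo9Y x) 1 (H x)) (blkBK x.toKIdx (bI x)) (blkHK x.toKIdx)
            (QcoKHq x.toKIdx (trBasis N) (bg9YR (Matrix (Fin N) (Fin N) ℂ) (specialUnitaryUnits (Fin N)) R₁ R₂ x) (fun U => U) (𝔮 x) U)
            (fun a a' => BQ * Real.exp (δ * ((θ.ℓ₆ : ℝ) + 4)) * Real.exp (-(δ * (geo9Y x).dist a a'))))
    -- the SCALED sup letter of G_D before the leaf (`gdsup_sq_of_pins`)
    (hGD : ∀ j : J, MG ≤ (geo9Y (f j)).M → ∀ α₀ : ℝ, 0 < α₀ → (geo9Y (f j)).M * α₀ ≤ aG →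
      ∀ U : (bg9YR (Matrix (Fin N) (Fin N) ℂ) (specialUnitaryUnits (Fin N)) R₁ R₂ (f j)).Cfg,
        (bg9YR (Matrix (Fin N) (Fin N) ℂ) (specialUnitaryUnits (Fin N)) R₁ R₂ (f j)).Reg335 c α₀ U →
        (bg9YR (Matrix (Fin N) (Fin N) ℂ) (specialUnitaryUnits (Fin N)) R₁ R₂ (f j)).Reg336 c α₀ U →
          HasMajorant (g := toB6 (geo9Y (f j)) 1 (H (f j))) (𝔬12 (f j)).blk ((𝔬12 (f j)).G U) (fun a b => rG * (geo9Y (f j)).len a ^ 2 * Real.exp (-(ρG * (geo9Y (f j)).dist a b))))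
    -- the (3.132) class letter of C (`zletters_of_pins`, conjunct 4)
    (hc2 : ∀ j : J, MG ≤ (geo9Y (f j)).M → ∀ α₀ : ℝ, 0 < α₀ → (geo9Y (f j)).M * α₀ ≤ aG →
      ∀ U : (bg9YR (Matrix (Fin N) (Fin N) ℂ) (specialUnitaryUnits (Fin N)) R₁ R₂ (f j)).Cfg,
        (bg9YR (Matrix (Fin N) (Fin N) ℂ) (specialUnitaryUnits (Fin N)) R₁ R₂ (f j)).Reg335 c α₀ U →
        (bg9YR (Matrix (Fin N) (Fin N) ℂ) (specialUnitaryUnits (Fin N)) R₁ R₂ (f j)).Reg336 c α₀ U →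
          HasMaj (cNorm 1 (H (f j)) (𝔬12 (f j)).blkZ (fun y => (geo9Y_len_pos (f j) y).le) 2)
            (weightNorm (BlockNorm.ofBlocks (toB6 (geo9Y (f j)) 1 (H (f j))) (𝔬12 (f j)).blkZ) (fun y => ((((θ.ℓ₆ + 1 : ℕ) : ℝ) ^ (θ.d₆ + 1)) ^ lvl (f j).hN (f j).D (f j).hk y)⁻¹)
              (fun y => (plateau_pos (f j).toKIdx y).le))
            ((𝔬12 (f j)).C U) (fun a b => Bz * Real.exp (-(δC * (geo9Y (f j)).dist a b))))
    -- [5] (149) for the form letter, at print's weight `(Lʲη)_c · n_c⁻¹`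
    (hC2 : ∀ x : MemberY θ.d₆ θ.ℓ₆ θ.hd' θ.hL' θ.b₀ θ.b₁ Mstar, MG ≤ (geo9Y x).M → ∀ α₀ : ℝ, 0 < α₀ → (geo9Y x).M * α₀ ≤ aG →
      ∀ U : (bg9YR (Matrix (Fin N) (Fin N) ℂ) (specialUnitaryUnits (Fin N)) R₁ R₂ x).Cfg,
        (bg9YR (Matrix (Fin N) (Fin N) ℂ) (specialUnitaryUnits (Fin N)) R₁ R₂ x).Reg335 c α₀ U →
        (bg9YR (Matrix (Fin N) (Fin N) ℂ) (specialUnitaryUnits (Fin N)) R₁ R₂ x).Reg336 c α₀ U →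
          C2FormMaj x.toKIdx (g := geo9Y x) (bI x) (fun c => c) (𝔠 x).form U κC δC2
            (fun c => (geo9Y x).len c * (((((θ.ℓ₆ + 1 : ℕ) : ℝ) ^ (θ.d₆ + 1)) ^ lvl x.hN x.D x.hk c)⁻¹))) :
    ∃ MD aD θ₂ : ℝ, 0 < aD ∧ aD ≤ aG ∧ 0 ≤ θ₂ ∧
      ∀ j : J, MD ≤ (geo9Y (f j)).M → ∀ α₀ : ℝ, 0 < α₀ → (geo9Y (f j)).M * α₀ ≤ aD →
        ∀ U : (bg9YR (Matrix (Fin N) (Fin N) ℂ) (specialUnitaryUnits (Fin N)) R₁ R₂ (f j)).Cfg,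
          (bg9YR (Matrix (Fin N) (Fin N) ℂ) (specialUnitaryUnits (Fin N)) R₁ R₂ (f j)).Reg335 c α₀ U →
          (bg9YR (Matrix (Fin N) (Fin N) ℂ) (specialUnitaryUnits (Fin N)) R₁ R₂ (f j)).Reg336 c α₀ U →
            HasMajorant (g := toB6 (geo9Y (f j)) 1 (H (f j))) (𝔬12 (f j)).blk
              (D2coK (f j).toKIdx (trBasis N) (bg9YR (Matrix (Fin N) (Fin N) ℂ) (specialUnitaryUnits (Fin N)) R₁ R₂ (f j)) (fun U => U)
                (delta2OfQY (trDualMatY N) (f j).toKIdx (𝔮 (f j)) (𝔮s (f j)) (parT (f j).toKIdx) (GpPhysY (f j).toKIdx (parT (f j).toKIdx)) (𝔠 (f j)).form) U)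
              (fun (a b : (geo9Y (f j)).Site) => θ₂ * ((geo9Y (f j)).M * α₀) * ((geo9Y (f j)).len a ^ 2)⁻¹ * Real.exp (-(δ₂ * (geo9Y (f j)).dist a b))) := by
  have hN : 0 < N := Nat.pos_of_ne_zero (NeZero.ne N)
  have hL0 : (0 : ℝ) ≤ ((θ.ℓ₆ + 1 : ℕ) : ℝ) := Nat.cast_nonneg _
  -- THE RATES OF THE ROAD, chosen here from the produced ones: target ρT below ρG, δC∕4 and the locality margin δC2 − δ₂; row sum σT = δC∕4; transfers τT = δC∕8; ρR = ρT∕2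
  set ρT : ℝ := min (min ρG (δC / 4)) (δC2 - δ₂) with hρTdef
  have hρT0 : 0 < ρT := lt_min (lt_min hρG (by linarith)) (by linarith)
  have hρT : 0 ≤ ρT := hρT0.le
  have hρTG : ρT ≤ ρG := (min_le_left _ _).trans (min_le_left _ _)
  have hρTC4 : ρT ≤ δC / 4 := (min_le_left _ _).trans (min_le_right _ _)
  have hρT2 : ρT ≤ δC2 - δ₂ := min_le_right _ _
  set σT : ℝ := δC / 4 with hσTdef
  have hσT : 0 < σT := by positivity
  set τT : ℝ := δC / 8 with hτTdef
  have hτT : 0 < τT := by positivity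
  set ρR : ℝ := ρT / 2 with hρRdef
  have hρR : 0 < ρR := by positivity
  -- an auxiliary side of primitive constants carrying the final transfer∕row-sum rates of n08-d's `(H*J)` lemma (only `α, αF, δ₀` matter): `αF(1−2α)δ₀ = ρT∕8`
  set qD : PinPrims := ⟨1 / 4, 0, 0, 0, 0, 1, 0, 0, 1, ρT, 1, 1, 1 / 4, 0, 0, 0, 0, 0, 0, 0, fun _ => 0, fun _ => 0, fun _ => 0, fun _ => 0, fun _ _ => 0⟩ with hqD
  have hq : qD.OK :=
    { α_pos := by norm_num [hqD], α_lt := by norm_num [hqD], Nc_nn := le_rfl, N'_nn := le_rfl, NF_nn := le_rfl, one_le_Cℓ := le_rfl, Kc_nn := le_rfl, θ₀_nn := le_rfl,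
      B₀_pos := one_pos, δ₀_pos := hρT0, a₁_pos := one_pos, M₁_pos := one_pos, αF_pos := by norm_num [hqD], αF_lt := by norm_num [hqD], NH_nn := le_rfl, NL_nn := le_rfl,
      BL_nn := le_rfl, NI_nn := le_rfl, N2_nn := le_rfl, B2_nn := le_rfl, θ2_nn := le_rfl, Bl_nn := fun _ _ _ => le_rfl, Bt_nn := fun _ _ _ => le_rfl,
      BI_nn := fun _ _ _ => le_rfl, BI2_nn := fun _ _ _ _ _ _ => le_rfl, θI_nn := fun _ _ => le_rfl }
  have hrate : qD.αF * ((1 - 2 * qD.α) * qD.δ₀) = ρT / 8 := by simp only [hqD]; ring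
  have hδC2' : δ₂ + qD.αF * ((1 - 2 * qD.α) * qD.δ₀) + ρR ≤ δC2 := by rw [hrate, hρRdef]; linarith
  have hρ' : qD.αF * ((1 - 2 * qD.α) * qD.δ₀) + ρR ≤ ρT := by rw [hrate, hρRdef]; linarith
  have hρTC : ρT + σT + τT ≤ δC - 1 / 2 * (2 * τT) := by rw [hσTdef, hτTdef]; linarith
  -- member facts for the len⁻² transfer inside F11 (rate τT at α := ½)
  obtain ⟨Mg, hFa⟩ := facts347_exp261_geo9Y (d := θ.d₆) (ℓ := θ.ℓ₆) (hd := θ.hd') (hL := θ.hL') (b₀ := θ.b₀) (b₁ := θ.b₁) (Mstar := Mstar) H (α := 1 / 2) (δ := 2 * τT)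
    (by norm_num) (by norm_num) (by linarith)
  -- the named constants of the road
  set cJ : ℝ := 10 * ((θ.ℓ₆ + 1 : ℕ) : ℝ) ^ 7 with hcJ
  have hcJ0 : 0 < cJ := by positivity
  set rC : ℝ := Bz * (((θ.ℓ₆ + 1 : ℕ) : ℝ)) ^ 2 with hrC
  have hrC0 : 0 ≤ rC := by positivity
  set tHJ : ℝ := N * basisBound39 (trBasis N) ^ 2 * (10 ^ 4 * ((θ.d₆ : ℝ) + 1) * cJ) *
      (((θ.d₆ : ℝ) + 1) * Fintype.card (TrIdx N) *
        (rC * ((BQ * Real.exp ((ρG + σT + 1 / 2 * (2 * τT)) * ((θ.ℓ₆ : ℝ) + 4))) * rG * (((θ.ℓ₆ + 1 : ℕ) : ℝ)) ^ 2 *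
          rowConst261 (geo9Y (d := θ.d₆) (ℓ := θ.ℓ₆) (hd := θ.hd') (hL := θ.hL') (b₀ := θ.b₀) (b₁ := θ.b₁) (Mstar := Mstar)) σT) * (((θ.ℓ₆ + 1 : ℕ) : ℝ)) ^ 2 *
          rowConst261 (geo9Y (d := θ.d₆) (ℓ := θ.ℓ₆) (hd := θ.hd') (hL := θ.hL') (b₀ := θ.b₀) (b₁ := θ.b₁) (Mstar := Mstar)) σT)) *
      ((((θ.ℓ₆ + 1 : ℕ) : ℝ) ^ 3) * rowConst261 (geo9Y (d := θ.d₆) (ℓ := θ.ℓ₆) (hd := θ.hd') (hL := θ.hL') (b₀ := θ.b₀) (b₁ := θ.b₁) (Mstar := Mstar)) ρR) with htHJ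
  set θ₂ : ℝ := (B9Thm39ReadingCoords.cR39 (trBasis N))⁻¹ * (2 * N * basisBound39 (trBasis N) ^ 2 * κC * tHJ * (((θ.ℓ₆ + 1 : ℕ) : ℝ) ^ 2) *
      rowConst261 (geo9Y (d := θ.d₆) (ℓ := θ.ℓ₆) (hd := θ.hd') (hL := θ.hL') (b₀ := θ.b₀) (b₁ := θ.b₁) (Mstar := Mstar)) ρR) with hθ₂
  have hc261σ := rowConst261_nonneg (geo9Y (d := θ.d₆) (ℓ := θ.ℓ₆) (hd := θ.hd') (hL := θ.hL') (b₀ := θ.b₀) (b₁ := θ.b₁) (Mstar := Mstar)) σT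
  have hc261ρ := rowConst261_nonneg (geo9Y (d := θ.d₆) (ℓ := θ.ℓ₆) (hd := θ.hd') (hL := θ.hL') (b₀ := θ.b₀) (b₁ := θ.b₁) (Mstar := Mstar)) ρR
  have htHJ0 : 0 ≤ tHJ := by positivity
  have hθ₂0 : 0 ≤ θ₂ := by
    have hc : 0 < B9Thm39ReadingCoords.cR39 (trBasis N) := cR39_trBasis_pos hN
    positivity
  -- the produced regime: inside `aG` and print's «O(1)Mα₀ ≤ 1» for the cube-covering letter (`cJ·a ≤ 1`)
  set aD : ℝ := min aG (1 / cJ) with haD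
  have haD0 : 0 < aD := lt_min haG (by positivity)
  have haDG : aD ≤ aG := min_le_left _ _
  have ha1 : cJ * aD ≤ 1 := by
    have h1 : cJ * aD ≤ cJ * (1 / cJ) := mul_le_mul_of_nonneg_left (min_le_right _ _) hcJ0.le
    rwa [mul_one_div_cancel hcJ0.ne'] at h1
  -- the three inputs of the scaled road in its currencies
  have hMpos : 0 < max MG 1 := lt_max_of_lt_right one_pos
  have hGDsup : ∀ j : J, max (max MG 1) Mg ≤ (geo9Y (f j)).M → ∀ α₀ : ℝ, 0 < α₀ → (geo9Y (f j)).M * α₀ ≤ aD →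
      ∀ U : (bg9YR (Matrix (Fin N) (Fin N) ℂ) (specialUnitaryUnits (Fin N)) R₁ R₂ (f j)).Cfg,
        (bg9YR (Matrix (Fin N) (Fin N) ℂ) (specialUnitaryUnits (Fin N)) R₁ R₂ (f j)).Reg335 c α₀ U →
        (bg9YR (Matrix (Fin N) (Fin N) ℂ) (specialUnitaryUnits (Fin N)) R₁ R₂ (f j)).Reg336 c α₀ U →
          HasMajorant (g := toB6 (geo9Y (f j)) 1 (H (f j))) (blkBK (f j).toKIdx (bI (f j)))
            (GcoK (f j).toKIdx (trBasis N) (bg9YR (Matrix (Fin N) (Fin N) ℂ) (specialUnitaryUnits (Fin N)) R₁ R₂ (f j)) (fun U => U)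
              (GDQY (f j).toKIdx (𝔮 (f j)) (𝔮s (f j)) (parT (f j).toKIdx) (GpPhysY (f j).toKIdx (parT (f j).toKIdx))) U)
            (fun a b => rG * (geo9Y (f j)).len a ^ 2 * Real.exp (-(ρG * (geo9Y (f j)).dist a b))) := by
    intro j hM α₀ hα ha U hU hU'
    have h := hGD j ((le_max_left _ _).trans ((le_max_left _ _).trans hM)) α₀ hα (ha.trans haDG) U hU hU'
    rw [hblk12 (f j), hGco12 (f j) U] at h
    exact h
  have hCsup : ∀ j : J, max (max MG 1) Mg ≤ (geo9Y (f j)).M → ∀ α₀ : ℝ, 0 < α₀ → (geo9Y (f j)).M * α₀ ≤ aD →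
      ∀ U : (bg9YR (Matrix (Fin N) (Fin N) ℂ) (specialUnitaryUnits (Fin N)) R₁ R₂ (f j)).Cfg,
        (bg9YR (Matrix (Fin N) (Fin N) ℂ) (specialUnitaryUnits (Fin N)) R₁ R₂ (f j)).Reg335 c α₀ U →
        (bg9YR (Matrix (Fin N) (Fin N) ℂ) (specialUnitaryUnits (Fin N)) R₁ R₂ (f j)).Reg336 c α₀ U →
          HasMajorant (g := toB6 (geo9Y (f j)) 1 (H (f j))) (blkHK (f j).toKIdx)
            (CcoKq (f j).toKIdx (trBasis N) (bg9YR (Matrix (Fin N) (Fin N) ℂ) (specialUnitaryUnits (Fin N)) R₁ R₂ (f j)) (fun U => U)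
              (𝔮 (f j)) (𝔮s (f j)) (parT (f j).toKIdx) (GpPhysY (f j).toKIdx (parT (f j).toKIdx)) U)
            (fun a b => rC * ((((((θ.ℓ₆ + 1 : ℕ) : ℝ) ^ (θ.d₆ + 1)) ^ lvl (f j).hN (f j).D (f j).hk a)⁻¹)⁻¹ * ((geo9Y (f j)).len a ^ 2)⁻¹) *
              Real.exp (-((δC - 1 / 2 * (2 * τT)) * (geo9Y (f j)).dist a b))) := by
    intro j hM α₀ hα ha U hU hU'
    have hG : GeoOK (geo9Y (f j)) := ⟨geo9Y_dist_triangle (f j), geo9Y_dist_comm (f j), geo9K_dist_nonneg (f j).toKIdx, geo9Y_len_pos (f j)⟩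
    have h := hc2 j ((le_max_left _ _).trans ((le_max_left _ _).trans hM)) α₀ hα (ha.trans haDG) U hU hU'
    rw [hblkZ12 (f j), hCco12 (f j) U] at h
    have h' := hasMajorantHom_of_hasMaj_cNorm_weightNorm (R₀ := 1) (H₀ := H (f j)) hG (hFa (f j) ((le_max_right _ _).trans hM)) hBz
      (W := fun y => ((((θ.ℓ₆ + 1 : ℕ) : ℝ) ^ (θ.d₆ + 1)) ^ lvl (f j).hN (f j).D (f j).hk y)⁻¹) (plateau_pos (f j).toKIdx) h
    refine hasMajorant_mono _ ((hasMajorantHom_iff _ _ _).1 h') fun a b => le_of_eq ?_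
    rw [hrC]
  have hreg : ∀ x : MemberY θ.d₆ θ.ℓ₆ θ.hd' θ.hL' θ.b₀ θ.b₁ Mstar, max (max MG 1) Mg ≤ (geo9Y x).M → ∀ α₀ : ℝ, 0 < α₀ → (geo9Y x).M * α₀ ≤ aD →
      ∀ U : (bg9YR (Matrix (Fin N) (Fin N) ℂ) (specialUnitaryUnits (Fin N)) R₁ R₂ x).Cfg,
        (bg9YR (Matrix (Fin N) (Fin N) ℂ) (specialUnitaryUnits (Fin N)) R₁ R₂ x).Reg335 c α₀ U →
        (bg9YR (Matrix (Fin N) (Fin N) ℂ) (specialUnitaryUnits (Fin N)) R₁ R₂ x).Reg336 c α₀ U →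
          ∀ μ s, B9Eq336CurrentBound.RegularAt (B9BackgroundsKLevelV1.shiftsV1 (B6GlobalChartV1.PV θ.d₆ θ.ℓ₆ x.toKIdx.m x.toKIdx.K θ.hd' θ.hL')) U (etaBY x.toKIdx)
            (cJ * ((geo9Y x).M * α₀)) ((geo9Y x).len (bI x ⟨s, 0⟩)) μ s :=
    fun x _ α₀ hα _ U _ hU' μ s => regularAt_pinScale_of_regYP336 x c35Y_le_ten hα.le (hRP2 x α₀ U hU').2 (bI x) (hβ1 x) μ ⟨s, 0⟩
  -- the scaled road
  obtain ⟨ML, hsup⟩ := hD2sup_of_GD_C_lettersRP_sq_q_J qD hq H f 𝔠 R₁ R₂ c 𝔮 𝔮s parT 𝔬12 bI hbI0 hblk12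
    (fun x c => (geo9Y x).len c * (((((θ.ℓ₆ + 1 : ℕ) : ℝ) ^ (θ.d₆ + 1)) ^ lvl x.hN x.D x.hk c)⁻¹))
    (fun x a => ((((((θ.ℓ₆ + 1 : ℕ) : ℝ) ^ (θ.d₆ + 1)) ^ lvl x.hN x.D x.hk a)⁻¹)⁻¹ * ((geo9Y x).len a ^ 2)⁻¹))
    (fun x c => mul_nonneg (geo9Y_len_pos x c).le (plateau_pos x.toKIdx c).le)
    (fun x a => mul_nonneg (inv_nonneg.mpr (plateau_pos x.toKIdx a).le) (inv_nonneg.mpr (pow_nonneg (geo9Y_len_pos x a).le 2)))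
    (fun x c => le_of_eq (weights_mul_eq (geo9Y_len_pos x c) (inv_pos.mp (plateau_pos x.toKIdx c))))
    κC δC2 rG ρG rC (δC - 1 / 2 * (2 * τT)) σT τT ρT cJ ρR tHJ δ₂ θ₂ (max (max MG 1) Mg) aD hκC hrG hrC0 hσT hτT hρT hρTG hρTC hcJ0.le hρR hδ₂
    (lt_max_of_lt_left hMpos) ha1 hδC2' hρ' hadj
    (fun x hM α₀ hα ha U hU hU' => hGDsym x ((le_max_left _ _).trans ((le_max_left _ _).trans hM)) α₀ hα (ha.trans haDG) U hU hU') BQ hBQ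
    (fun x hM α₀ hα ha U hU hU' => hQ15 x ((le_max_left _ _).trans ((le_max_left _ _).trans hM)) α₀ hα (ha.trans haDG) U hU hU')
    (le_of_eq htHJ.symm) (le_of_eq hθ₂.symm)
    (fun x hM α₀ hα ha U hU hU' => hC2 x ((le_max_left _ _).trans ((le_max_left _ _).trans hM)) α₀ hα (ha.trans haDG) U hU hU')
    hGDsup hCsup hreg
  exact ⟨max ML (max (max MG 1) Mg), aD, θ₂, haD0, haDG, hθ₂0, fun j hM α₀ hα ha U hU hU' =>
    hsup j ((le_max_left _ _).trans hM) ((le_max_right _ _).trans hM) α₀ hα ha U hU hU'⟩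

end Summit.QuantumFields.YangMills.BalabanUVNodes.N06D2SupLegAtPinsPUWQJ

end
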